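import Summits.AtomisticToContinuum.BoseEinsteinCondensation.Theorems.BECCutLineWeakDisorderLandscapeBoundSiblingDefs
import HarnessLib

/-!
# Route `BECCutLineWeakDisorder`, crux `LandscapeBound` (stmt-AtomisticToContinuum-9087),
# line `sibling-telescoping-chaining`: dyadic covering and children, the range of the sibling
# excess, the pointwise telescoping bound (registered bookkeeping stub `stub_telescope`)

Support file (`--supports stmt-AtomisticToContinuum-9087`; proves the registered bookkeeping stub
`stub_telescope : Goal.stub_telescope`, statement `TelescopeIneq` of
`Theorems/BECCutLineWeakDisorderLandscapeBoundSiblingDefs.lean`).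

* covering (`lintegral_le_sum_blockMass`: `∫ g ≤ Σ_Q a_Q` for `g` vanishing off the box;
  `levelSq_ne_zero`, `levelSq_ne_top`, `prod_ratio_eq`: `∏_{j<K} 8S_{j+1}/S_j = 8^K S_K/S_0`);
  children (`childIdx`, `childEquiv`, `dyadicCube_eq_iUnion_child`, `disjoint_dyadicCube`,
  `blockMass_eq_sum_children`: `a_Q = Σ_c a_c`; `levelSq_succ_le`: `S_{j+1} ≤ S_j`;
  `siblingExcess_le_seven`: `X_j ≤ 7`, junk cases included);
* `landscape_le_telescope` — the pointwise telescoping bound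
  `L³ (∫g²)²/(∫g)² ≤ r̄_K · ∏_{j<K} (1 + X_j) · ∫ g²` (junk cases included); `stub_telescope`.
-/

noncomputable section

open MeasureTheory Filter Set Finset
open scoped ENNReal NNReal Topology BigOperators

namespace Summit.AtomisticToContinuum.BoseEinsteinCondensation.Cruxes.LandscapeBound.SiblingTelescopingChaining

open Literature.MathematicalPhysics.QuantumManyBody.BoseGas

/-- **The level-`j` blocks cover the box.** [folklore] -/
theorem exists_mem_dyadicCube {L : ℝ} (hL : 0 < L) (j : ℕ) {x : Space} (hx : x ∈ box L) :
    ∃ i : Fin 3 → Fin (2 ^ j), x ∈ dyadicCube L j i := by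
  have h2 : (0 : ℝ) < 2 ^ j := by positivity
  have ht : ∀ d : Fin 3, 0 ≤ x d * 2 ^ j / L ∧ x d * 2 ^ j / L < (2 ^ j : ℕ) := by
    intro d
    obtain ⟨h0, h1⟩ := hx d
    refine ⟨by positivity, ?_⟩
    rw [div_lt_iff₀ hL]
    push_cast
    nlinarith
  refine ⟨fun d => ⟨⌊x d * 2 ^ j / L⌋₊, (Nat.floor_lt (ht d).1).2 (ht d).2⟩, fun d => ?_⟩
  simp only [Set.mem_Ico]
  have hfl := Nat.floor_le (ht d).1
  have hlt := Nat.lt_floor_add_one (x d * 2 ^ j / L)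
  constructor
  · rw [div_le_iff₀ h2]
    have := mul_le_mul_of_nonneg_left hfl hL.le
    calc L * (⌊x d * 2 ^ j / L⌋₊ : ℝ) ≤ L * (x d * 2 ^ j / L) := this
      _ = x d * 2 ^ j := by field_simp
  · rw [lt_div_iff₀ h2]
    have := mul_lt_mul_of_pos_left hlt hL
    calc x d * 2 ^ j = L * (x d * 2 ^ j / L) := by field_simp
      _ < L * ((⌊x d * 2 ^ j / L⌋₊ : ℝ) + 1) := this

/-- `Λ_L ⊆ ⋃_i Q_{j,i}`. [folklore] -/
theorem box_subset_iUnion_dyadicCube {L : ℝ} (hL : 0 < L) (j : ℕ) :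
    box L ⊆ ⋃ i : Fin 3 → Fin (2 ^ j), dyadicCube L j i := fun _ hx =>
  Set.mem_iUnion.2 (exists_mem_dyadicCube hL j hx)

/-- The whole mass is covered by the level-`j` blocks: `∫ g ≤ Σ_Q a_Q` for `g` vanishing off
`Λ_L`. [folklore] -/
theorem lintegral_le_sum_blockMass {g : Space → ℝ≥0∞} {L : ℝ} (hL : 0 < L)
    (h0 : ∀ x, x ∉ box L → g x = 0) (j : ℕ) :
    ∫⁻ x, g x ≤ ∑ i : Fin 3 → Fin (2 ^ j), blockMass g L j i := by
  have hind : g = (box L).indicator g := by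
    funext x
    by_cases hx : x ∈ box L
    · rw [Set.indicator_of_mem hx]
    · rw [Set.indicator_of_notMem hx, h0 x hx]
  calc ∫⁻ x, g x = ∫⁻ x in box L, g x := by
        conv_lhs => rw [hind]
        rw [lintegral_indicator (measurableSet_box L)]
    _ ≤ ∫⁻ x in ⋃ i : Fin 3 → Fin (2 ^ j), dyadicCube L j i, g x :=
        lintegral_mono_set (box_subset_iUnion_dyadicCube hL j)
    _ ≤ ∑' i : Fin 3 → Fin (2 ^ j), ∫⁻ x in dyadicCube L j i, g x := lintegral_iUnion_le _ _
    _ = ∑ i : Fin 3 → Fin (2 ^ j), blockMass g L j i := by rw [tsum_fintype]; rfl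

/-- Each block mass is at most the whole mass. [folklore] -/
theorem blockMass_le_lintegral (g : Space → ℝ≥0∞) (L : ℝ) (j : ℕ) (i : Fin 3 → Fin (2 ^ j)) :
    blockMass g L j i ≤ ∫⁻ x, g x :=
  setLIntegral_le_lintegral _ _

/-- At level `0` there is one block, so `S_0 = a_{[0,L)³}² ≤ (∫ g)²`. [folklore] -/
theorem levelSq_zero_le (g : Space → ℝ≥0∞) (L : ℝ) : levelSq g L 0 ≤ (∫⁻ x, g x) ^ 2 := by
  unfold levelSq
  calc ∑ i : Fin 3 → Fin (2 ^ 0), blockMass g L 0 i ^ 2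
      ≤ ∑ _i : Fin 3 → Fin (2 ^ 0), (∫⁻ x, g x) ^ 2 :=
        Finset.sum_le_sum fun i _ => pow_le_pow_left' (blockMass_le_lintegral g L 0 i) 2
    _ = (∫⁻ x, g x) ^ 2 := by
        rw [Finset.sum_const, Finset.card_univ, Fintype.card_fun, Fintype.card_fin,
          Fintype.card_fin]
        simp

/-- If `0 < ∫ g` (and `g` vanishes off the box) then every `S_j` is nonzero. [folklore] -/
theorem levelSq_ne_zero {g : Space → ℝ≥0∞} {L : ℝ} (hL : 0 < L)
    (h0 : ∀ x, x ∉ box L → g x = 0) (hs : ∫⁻ x, g x ≠ 0) (j : ℕ) : levelSq g L j ≠ 0 := by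
  intro h
  have hall : ∀ i : Fin 3 → Fin (2 ^ j), blockMass g L j i = 0 := by
    intro i
    have := (Finset.sum_eq_zero_iff.1 h) i (Finset.mem_univ _)
    exact pow_eq_zero_iff (n := 2) (by norm_num) |>.1 this
  have := lintegral_le_sum_blockMass hL h0 j
  simp only [hall, Finset.sum_const_zero, nonpos_iff_eq_zero] at this
  exact hs this

/-- Every `S_j` is finite when `∫ g` is. [folklore] -/
theorem levelSq_ne_top {g : Space → ℝ≥0∞} {L : ℝ} (hs : ∫⁻ x, g x ≠ ⊤) (j : ℕ) :
    levelSq g L j ≠ ⊤ := by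
  refine ENNReal.sum_ne_top.2 fun i _ => ENNReal.pow_ne_top ?_
  exact ne_top_of_le_ne_top hs (blockMass_le_lintegral g L j i)

/-- **Telescoping over the reals**: `∏_{j<K} 8 S_{j+1}/S_j = 8^K S_K / S_0` when no `S_j`
vanishes or is infinite. [folklore] -/
theorem prod_ratio_eq {g : Space → ℝ≥0∞} {L : ℝ}
    (hne : ∀ j, (levelSq g L j).toReal ≠ 0) (K : ℕ) :
    ∏ j ∈ range K, (8 * levelSq g L (j + 1)).toReal / (levelSq g L j).toReal =
      8 ^ K * (levelSq g L K).toReal / (levelSq g L 0).toReal := by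
  induction K with
  | zero => simp [hne 0]
  | succ K ih =>
    rw [Finset.prod_range_succ, ih, ENNReal.toReal_mul]
    have h0 := hne 0
    have hK := hne K
    simp only [ENNReal.toReal_ofNat]
    field_simp
    ring

/-- **The pointwise telescoping bound** (the exact identity `R = r̄_K ∏_{j<K} ⟨σ⟩_j` of the card,
in the inequality form the composition needs, junk cases included): for `g ≥ 0` measurable,
bounded, vanishing off `Λ_L`,
`L³ (∫g²)²/(∫g)² ≤ r̄_K · ∏_{j<K} (1 + X_j) · ∫ g²`. [folklore] -/
theorem landscape_le_telescope {g : Space → ℝ≥0∞} (hg : Measurable g) {L : ℝ} (hL : 0 < L)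
    (h0 : ∀ x, x ∉ box L → g x = 0) {M : ℝ≥0∞} (hM : M ≠ ⊤) (hgM : ∀ x, g x ≤ M) (K : ℕ) :
    ENNReal.ofReal (L ^ 3) * (∫⁻ x, g x ^ 2) ^ 2 / (∫⁻ x, g x) ^ 2 ≤
      uvParticipation g L K *
        ENNReal.ofReal (∏ j ∈ range K, (1 + siblingExcess g L j)) * ∫⁻ x, g x ^ 2 := by
  set s : ℝ≥0∞ := ∫⁻ x, g x with hsdef
  set m : ℝ≥0∞ := ∫⁻ x, g x ^ 2 with hmdef
  by_cases hs0 : s = 0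
  · have hm0 : m = 0 := by
      have h1 := (lintegral_eq_zero_iff hg).1 hs0
      refine (lintegral_eq_zero_iff (hg.pow_const 2)).2 ?_
      filter_upwards [h1] with x hx
      simp only [Pi.zero_apply] at hx ⊢
      simp [hx]
    simp [hm0]
  by_cases hstop : s = ⊤
  · simp [hstop]
  have hms : m ≤ M * s := by
    calc m = ∫⁻ x, g x * g x := by rw [hmdef]; exact lintegral_congr fun x => sq (g x)
      _ ≤ ∫⁻ x, M * g x := lintegral_mono fun x => mul_le_mul' (hgM x) le_rfl
      _ = M * s := by rw [lintegral_const_mul _ hg]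
  have hmtop : m ≠ ⊤ := ne_top_of_le_ne_top (ENNReal.mul_ne_top hM hstop) hms
  have hSne0 : ∀ j, levelSq g L j ≠ 0 := levelSq_ne_zero hL h0 hs0
  have hSnetop : ∀ j, levelSq g L j ≠ ⊤ := levelSq_ne_top hstop
  have hSr : ∀ j, (levelSq g L j).toReal ≠ 0 := fun j =>
    ENNReal.toReal_ne_zero.2 ⟨hSne0 j, hSnetop j⟩
  have hSrpos : ∀ j, 0 < (levelSq g L j).toReal := fun j =>
    ENNReal.toReal_pos (hSne0 j) (hSnetop j)
  have hsr : 0 < s.toReal := ENNReal.toReal_pos hs0 hstop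
  have hprod : ∏ j ∈ range K, (1 + siblingExcess g L j) =
      8 ^ K * (levelSq g L K).toReal / (levelSq g L 0).toReal := by
    rw [← prod_ratio_eq hSr K]
    refine Finset.prod_congr rfl fun j _ => ?_
    unfold siblingExcess
    ring
  have hprod_nn : 0 ≤ 8 ^ K * (levelSq g L K).toReal / (levelSq g L 0).toReal := by positivity
  have hs_eq : s = ENNReal.ofReal s.toReal := (ENNReal.ofReal_toReal hstop).symm
  have hm_eq : m = ENNReal.ofReal m.toReal := (ENNReal.ofReal_toReal hmtop).symm
  have hS_eq : ∀ j, levelSq g L j = ENNReal.ofReal (levelSq g L j).toReal := fun j =>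
    (ENNReal.ofReal_toReal (hSnetop j)).symm
  have hL3 : 0 ≤ L ^ 3 := by positivity
  have hl3 : 0 ≤ (L / 2 ^ K) ^ 3 := by positivity
  have hLHS : ENNReal.ofReal (L ^ 3) * m ^ 2 / s ^ 2 =
      ENNReal.ofReal (L ^ 3 * m.toReal ^ 2 / s.toReal ^ 2) := by
    rw [hm_eq, hs_eq, ENNReal.toReal_ofReal ENNReal.toReal_nonneg,
      ENNReal.toReal_ofReal ENNReal.toReal_nonneg, ← ENNReal.ofReal_pow ENNReal.toReal_nonneg,
      ← ENNReal.ofReal_pow ENNReal.toReal_nonneg, ← ENNReal.ofReal_mul hL3,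
      ← ENNReal.ofReal_div_of_pos (by positivity)]
  have hRHS : uvParticipation g L K *
        ENNReal.ofReal (∏ j ∈ range K, (1 + siblingExcess g L j)) * m =
      ENNReal.ofReal ((L / 2 ^ K) ^ 3 * m.toReal / (levelSq g L K).toReal *
        (8 ^ K * (levelSq g L K).toReal / (levelSq g L 0).toReal) * m.toReal) := by
    unfold uvParticipation
    rw [hprod, ← hmdef]
    conv_lhs => rw [hm_eq, hS_eq K, ENNReal.toReal_ofReal ENNReal.toReal_nonneg]
    rw [← ENNReal.ofReal_mul hl3, ← ENNReal.ofReal_div_of_pos (hSrpos K),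
      ← ENNReal.ofReal_mul (by positivity), ← ENNReal.ofReal_mul (by positivity)]
  rw [hLHS, hRHS]
  refine ENNReal.ofReal_le_ofReal ?_
  have hS0le : (levelSq g L 0).toReal ≤ s.toReal ^ 2 := by
    have h := levelSq_zero_le g L
    rw [← hsdef] at h
    have h' := ENNReal.toReal_mono (ENNReal.pow_ne_top hstop) h
    rwa [ENNReal.toReal_pow] at h'
  have h2K : (0 : ℝ) < 2 ^ K := by positivity
  have hkey : (L / 2 ^ K) ^ 3 * m.toReal / (levelSq g L K).toReal *
      (8 ^ K * (levelSq g L K).toReal / (levelSq g L 0).toReal) * m.toReal =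
      L ^ 3 * m.toReal ^ 2 / (levelSq g L 0).toReal := by
    have h8 : (8 : ℝ) ^ K = (2 ^ K) ^ 3 := by
      rw [← pow_mul, show (8 : ℝ) = 2 ^ 3 by norm_num, ← pow_mul, mul_comm]
    have hK0 := hSr K
    have h00 := hSr 0
    rw [h8]
    field_simp
  rw [hkey]
  exact div_le_div_of_nonneg_left (by positivity) (hSrpos 0) hS0le

/-- The multi-index of the child `e ∈ {0,1}³` of the level-`j` block `i`: coordinatewise
`2 i_d + e_d`. [folklore] -/
def childIdx {j : ℕ} (i : Fin 3 → Fin (2 ^ j)) (e : Fin 3 → Fin 2) : Fin 3 → Fin (2 ^ (j + 1)) :=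
  fun d => ⟨2 * (i d : ℕ) + (e d : ℕ), by
    have hi := (i d).isLt
    have he := (e d).isLt
    rw [pow_succ]
    omega⟩

/-- `(childIdx i e)_d = 2 i_d + e_d`. [folklore] -/
theorem childIdx_apply {j : ℕ} (i : Fin 3 → Fin (2 ^ j)) (e : Fin 3 → Fin 2) (d : Fin 3) :
    (childIdx i e d : ℕ) = 2 * (i d : ℕ) + (e d : ℕ) := rfl

/-- For a fixed parent, distinct `e` give distinct children. [folklore] -/
theorem childIdx_injective {j : ℕ} (i : Fin 3 → Fin (2 ^ j)) :
    Function.Injective (childIdx i) := by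
  intro e e' h
  funext d
  have hd := congrArg (fun k : Fin 3 → Fin (2 ^ (j + 1)) => (k d : ℕ)) h
  simp only [childIdx_apply] at hd
  exact Fin.ext (by omega)

/-- **Parent/child bijection**: `(i, e) ↦ childIdx i e` is a bijection from (level-`j` indices) ×
`{0,1}³` onto the level-`(j+1)` indices; the inverse is `k ↦ (⌊k/2⌋, k mod 2)` coordinatewise.
[folklore] -/
def childEquiv (j : ℕ) :
    (Fin 3 → Fin (2 ^ j)) × (Fin 3 → Fin 2) ≃ (Fin 3 → Fin (2 ^ (j + 1))) where
  toFun p := childIdx p.1 p.2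
  invFun k :=
    (fun d => ⟨(k d : ℕ) / 2, by
        have h := (k d).isLt
        have h2 : 2 ^ (j + 1) = 2 ^ j * 2 := pow_succ 2 j
        omega⟩,
      fun d => ⟨(k d : ℕ) % 2, Nat.mod_lt _ two_pos⟩)
  left_inv p := by
    obtain ⟨i, e⟩ := p
    refine Prod.ext ?_ ?_ <;> funext d <;> apply Fin.ext
    · show (2 * (i d : ℕ) + (e d : ℕ)) / 2 = i d
      have := (e d).isLt
      omega
    · show (2 * (i d : ℕ) + (e d : ℕ)) % 2 = e d
      have := (e d).isLt
      omega
  right_inv k := by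
    funext d
    apply Fin.ext
    show 2 * ((k d : ℕ) / 2) + (k d : ℕ) % 2 = k d
    omega

/-- For `L ≤ 0` every dyadic block is empty (its defining intervals are empty). [folklore] -/
theorem dyadicCube_eq_empty {L : ℝ} (hL : L ≤ 0) (j : ℕ) (i : Fin 3 → Fin (2 ^ j)) :
    dyadicCube L j i = ∅ := by
  refine Set.eq_empty_of_forall_notMem fun x hx => ?_
  obtain ⟨h1, h2⟩ := hx 0
  have h2j : (0 : ℝ) < 2 ^ j := by positivity
  rw [div_le_iff₀ h2j] at h1
  rw [lt_div_iff₀ h2j] at h2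
  nlinarith

/-- **A block is the union of its `8` children** (for `0 < L`). [folklore] -/
theorem dyadicCube_eq_iUnion_child {L : ℝ} (hL : 0 < L) (j : ℕ) (i : Fin 3 → Fin (2 ^ j)) :
    dyadicCube L j i = ⋃ e : Fin 3 → Fin 2, dyadicCube L (j + 1) (childIdx i e) := by
  have hc : 0 < L / 2 ^ (j + 1) := by positivity
  have h1 : ∀ t : ℝ, L * t / 2 ^ j = L / 2 ^ (j + 1) * (2 * t) := fun t => by ring
  have h2 : ∀ t : ℝ, L * t / 2 ^ (j + 1) = L / 2 ^ (j + 1) * t := fun t => by ring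
  ext x
  simp only [dyadicCube, Set.mem_setOf_eq, Set.mem_iUnion, Set.mem_Ico, childIdx_apply,
    Nat.cast_add, Nat.cast_mul, Nat.cast_ofNat, h1, h2]
  generalize L / 2 ^ (j + 1) = c at hc ⊢
  constructor
  · intro hx
    refine ⟨fun d => if x d < c * (2 * ((i d : ℕ) : ℝ) + 1) then 0 else 1, fun d => ?_⟩
    obtain ⟨hlo, hhi⟩ := hx d
    dsimp only
    split_ifs with hlt
    · simp only [Fin.val_zero, Nat.cast_zero, add_zero]
      exact ⟨hlo, hlt⟩
    · simp only [Fin.val_one, Nat.cast_one]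
      exact ⟨not_lt.mp hlt, by linarith⟩
  · rintro ⟨e, he⟩ d
    obtain ⟨hlo, hhi⟩ := he d
    have he0 : (0 : ℝ) ≤ ((e d : ℕ) : ℝ) := Nat.cast_nonneg _
    have he1 : ((e d : ℕ) : ℝ) ≤ 1 := by
      have := (e d).isLt
      exact_mod_cast (by omega : (e d : ℕ) ≤ 1)
    constructor
    · nlinarith [mul_nonneg hc.le he0]
    · nlinarith [mul_le_mul_of_nonneg_left he1 hc.le]

/-- **Distinct blocks of the same level are disjoint.** [folklore] -/
theorem disjoint_dyadicCube (L : ℝ) (j : ℕ) {i i' : Fin 3 → Fin (2 ^ j)} (h : i ≠ i') :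
    Disjoint (dyadicCube L j i) (dyadicCube L j i') := by
  rcases le_or_gt L 0 with hL | hL
  · simp [dyadicCube_eq_empty hL]
  obtain ⟨d, hd⟩ := Function.ne_iff.mp h
  have hd' : (i d : ℕ) ≠ (i' d : ℕ) := fun h' => hd (Fin.ext h')
  rw [Set.disjoint_left]
  intro x hx hx'
  obtain ⟨h1, h2⟩ := hx d
  obtain ⟨h1', h2'⟩ := hx' d
  have h2j : (0 : ℝ) < 2 ^ j := by positivity
  rw [div_le_iff₀ h2j] at h1 h1'
  rw [lt_div_iff₀ h2j] at h2 h2'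
  rcases Nat.lt_or_gt_of_ne hd' with hlt | hlt
  · have hle : ((i d : ℕ) : ℝ) + 1 ≤ ((i' d : ℕ) : ℝ) := by exact_mod_cast hlt
    nlinarith [mul_le_mul_of_nonneg_left hle hL.le]
  · have hle : ((i' d : ℕ) : ℝ) + 1 ≤ ((i d : ℕ) : ℝ) := by exact_mod_cast hlt
    nlinarith [mul_le_mul_of_nonneg_left hle hL.le]

/-- The `8` children of a block are pairwise disjoint. [folklore] -/
theorem pairwise_disjoint_child (L : ℝ) {j : ℕ} (i : Fin 3 → Fin (2 ^ j)) :
    Pairwise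
      (Function.onFun Disjoint fun e : Fin 3 → Fin 2 => dyadicCube L (j + 1) (childIdx i e)) :=
  fun _ _ h => disjoint_dyadicCube L (j + 1) fun h' => h (childIdx_injective i h')

/-- **Additivity**: `a_Q = Σ_{c child of Q} a_c` (for `0 < L`; no measurability of `g` needed).
[folklore] -/
theorem blockMass_eq_sum_children {L : ℝ} (hL : 0 < L) (g : Space → ℝ≥0∞) (j : ℕ)
    (i : Fin 3 → Fin (2 ^ j)) :
    blockMass g L j i = ∑ e : Fin 3 → Fin 2, blockMass g L (j + 1) (childIdx i e) := by
  unfold blockMass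
  rw [dyadicCube_eq_iUnion_child hL j i,
    lintegral_iUnion (fun e => measurableSet_dyadicCube L (j + 1) (childIdx i e))
      (pairwise_disjoint_child L i),
    tsum_fintype]

/-- For `L ≤ 0` all block masses vanish. [folklore] -/
theorem blockMass_eq_zero_of_nonpos {L : ℝ} (hL : L ≤ 0) (g : Space → ℝ≥0∞) (j : ℕ)
    (i : Fin 3 → Fin (2 ^ j)) : blockMass g L j i = 0 := by
  simp [blockMass, dyadicCube_eq_empty hL]

/-- For `L ≤ 0` all `S_j` vanish. [folklore] -/
theorem levelSq_eq_zero_of_nonpos {L : ℝ} (hL : L ≤ 0) (g : Space → ℝ≥0∞) (j : ℕ) :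
    levelSq g L j = 0 := by
  simp [levelSq, blockMass_eq_zero_of_nonpos hL]

/-- `S_{j+1}` regrouped by parents: `S_{j+1} = Σ_Q Σ_{c child of Q} a_c²`. [folklore] -/
theorem levelSq_succ_eq (g : Space → ℝ≥0∞) (L : ℝ) (j : ℕ) :
    levelSq g L (j + 1) =
      ∑ i : Fin 3 → Fin (2 ^ j), ∑ e : Fin 3 → Fin 2, blockMass g L (j + 1) (childIdx i e) ^ 2 := by
  unfold levelSq
  rw [← (childEquiv j).sum_comp, Fintype.sum_prod_type]
  rfl

/-- `Σ_{e ∈ s} a_e² ≤ (Σ_{e ∈ s} a_e)²` in `[0, ∞]`. [folklore] -/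
theorem sum_sq_le_sq_sum {ι : Type*} (s : Finset ι) (a : ι → ℝ≥0∞) :
    ∑ e ∈ s, a e ^ 2 ≤ (∑ e ∈ s, a e) ^ 2 := by
  calc ∑ e ∈ s, a e ^ 2 = ∑ e ∈ s, a e * a e := by simp only [sq]
    _ ≤ ∑ e ∈ s, a e * ∑ e' ∈ s, a e' :=
        Finset.sum_le_sum fun e he => by
          gcongr
          exact Finset.single_le_sum_of_canonicallyOrdered he
    _ = (∑ e ∈ s, a e) ^ 2 := by rw [sq, Finset.sum_mul]

/-- **`S_{j+1} ≤ S_j`** (`Σ_c a_c² ≤ (Σ_c a_c)² = a_Q²` blockwise; both sides vanish for `L ≤ 0`).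
[folklore] -/
theorem levelSq_succ_le (g : Space → ℝ≥0∞) (L : ℝ) (j : ℕ) :
    levelSq g L (j + 1) ≤ levelSq g L j := by
  rcases le_or_gt L 0 with hL | hL
  · simp [levelSq_eq_zero_of_nonpos hL]
  rw [levelSq_succ_eq]
  unfold levelSq
  gcongr with i
  rw [blockMass_eq_sum_children hL]
  exact sum_sq_le_sq_sum _ _

/-- **`X_j ≤ 7`** in all cases (junk value `-1` when `S_j ∈ {0, ∞}`). [folklore] -/
theorem siblingExcess_le_seven (g : Space → ℝ≥0∞) (L : ℝ) (j : ℕ) :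
    siblingExcess g L j ≤ 7 := by
  unfold siblingExcess
  rcases eq_or_ne (levelSq g L j).toReal 0 with h0 | h0
  · rw [h0, div_zero]
    norm_num
  have htop : levelSq g L j ≠ ⊤ := fun h => h0 (by simp [h])
  have hpos : 0 < (levelSq g L j).toReal := lt_of_le_of_ne ENNReal.toReal_nonneg (Ne.symm h0)
  have hle : (levelSq g L (j + 1)).toReal ≤ (levelSq g L j).toReal :=
    ENNReal.toReal_mono htop (levelSq_succ_le g L j)
  rw [sub_le_iff_le_add, div_le_iff₀ hpos, ENNReal.toReal_mul, ENNReal.toReal_ofNat]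
  linarith

/-- PROVED bookkeeping stub `stub_telescope` (`TelescopeIneq`: `X_j ≤ 7` and the pointwise
telescoping bound). -/
theorem stub_telescope : Goal.stub_telescope :=
  ⟨siblingExcess_le_seven, fun _ hg _ hL h0 _ hM hgM K => landscape_le_telescope hg hL h0 hM hgM K⟩

end Summit.AtomisticToContinuum.BoseEinsteinCondensation.Cruxes.LandscapeBound.SiblingTelescopingChaining

end
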